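import Summits.BirchSwinnertonDyer.BirchSwinnertonDyer.Theorems.GenusKolyvaginAtTwoShaCardDvdPowAtTwoRTSharpExponentRat
import Summits.BirchSwinnertonDyer.BirchSwinnertonDyer.Theorems.GenusKolyvaginAtTwoShaCardDvdPowAtTwoPosTArchimedeanMarginOne
import Summits.BirchSwinnertonDyer.BirchSwinnertonDyer.Theorems.ByReductionTypeAtTwoRankOneAtTwoOffBigImageOddLocalEngineRegularDualityRat
import Summits.BirchSwinnertonDyer.BirchSwinnertonDyer.Theorems.ByReductionTypeAtTwoRankOneAtTwoOffBigImageOddLocalEngineRegularKolyvaginPrimeDictionary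
import Summits.BirchSwinnertonDyer.BirchSwinnertonDyer.Theorems.ByReductionTypeAtTwoRankOneAtTwoOffBigImageOddLocalEngineLocalTriviality
import HarnessLib

/-!
# Route `GenusKolyvaginAtTwo`, crux U⁺_T `ShaCardDvdPowAtTwoPosT` (stmt-BirchSwinnertonDyer-23378; `Δ(E) > 0`) and U_T′ (23469; `Δ < 0`) —
# (B2Q±) KOLYVAGIN'S THEOREM B₂ AT `l = 2` OVER `ℚ`, SHARP, FOR EITHER SIGN OF `Δ`, MODULO ONE ENGINE LEMMA:
# `2^{M₀} · Sel_(2^M)(E/ℚ) = 0` from a REGULAR SIGNED PAIR-ČEBOTAREV supply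

Seat `bsd-line-gk2-p5` g31 (WIDTH-5 attach, cell `bsd-f1-sign2`), `--supports stmt-BirchSwinnertonDyer-23378 --as helper` (closes nothing).
THEOREMS ONLY (no definition, no named fact, no `sorry`).  BSD is NOT proved by any of this; neither is U⁺_T, U_T′, Q4_T nor any stub.

WHAT.  gk2-p4 g22's (B2Q) `…RTSharpExponentRat.two_pow_smul_selmer_rat_eq_zero_onHabitat` (LINE 19, on U_T's `Δ < 0` frame) re-assembled with
its hypothesis `Δ(E) < 0` DELETED.  gk2-p4 g23 (STATUS 2026-08-30T00:08Z (b)) located the four uses of `Δ < 0` in that proof; here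
(2) the archimedean Selmer condition of the ℚ-descended class is this seat's `SelmerDescent.mem_selmerLocalKer_infinitePlace_of_resTorsion_eq_kolyvaginClass_two_of_margin`
    (p752988: FREE at margin one, no lost bit);
(3) McCallum 5.3 + 2.2 over `ℚ_ℓ` is the sibling crux 23716's `OffBigImageOddLocalAtTwo.Engine.lemma_5_3_rat_two_regular` (any sign of `Δ`);
(4) the `ℚ_ℓ ↔ K_λ` dictionary is `Engine.zsmul_mem_torsionLocalKer_iff_resTorsion_of_notMem_regular`, and «`Γ_{K_λ}` fixes `E[2^{M+1}]`» is
    `Engine.absGaloisRestrict_smul_geomTorsion_eq_regular`;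
(1) the Čebotarev step — gk2-p2's `infinite_kolyvaginPrime_localization_fullOrder_pair` (a `Frob ℓ = Frob ∞` prime with FULL local orders for the
    `τ`-eigenpair `(ι_* res s, ι_* c_{M+1}(1))` of signs `(+, −)`) — is the ONE input with no regular twin in the tree; it is DISPLAYED as the
    hypothesis `hPair` («regular signed pair-Čebotarev supply»): for every level `2^{n+1}`, the non-trivial `c ∈ Aut(K/ℚ)`, and every separated
    `c`-eigenpair `(x, y)` of exact orders `2^{ex}, 2^{ey}` (signs `±1`), a Zhang–Kolyvagin prime `ℓ` of index `≥ n + 1` with a Frobenius `h` above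
    `ℓ` that is an INVOLUTION of `E[2^{n+1}]` MOVING a `2`-torsion point (regular) and acts on `K` as some complex conjugation `c₀`, at whose
    place(s) `λ` both classes have FULL local order.  It is the signed (`c_* c_i = ± c_{π i}`) form of the route's landed
    `regularKolyvaginSupplyAtTwo_proof` (p664271, `c_* c_i = c_{π i}`) cut to a pair: GK2's `…EquivariantChebotarevAtTwoSignedStepB` ported
    `c₀ ↦ h₀`, = sibling `Engine.exists_orders_regular` with signs.  On `Δ < 0` it holds with `h = c₀` (the tree's pair theorem + Q1); on `Δ > 0`
    it is OPEN in the tree (LINE 16_T material).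

* `two_pow_smul_selmer_rat_eq_zero_of_regularPairSupply` — U_T's frame WITHOUT `Δ < 0` (globally minimal, non-CM, odd Tamagawa, an odd
  multiplicative prime for (NPh), `ρ_{E,2^n}` onto; `K` imaginary quadratic, `d_K` odd `≠ −3`, Heegner, the two non-square side conditions; frame
  `(Dt, β, ι)`, `d₁` with `2^{M₀+1} ∤ P(1)`; `w(E) = +1`; Q2 by name) + `hPair` ⟹ `2^{M₀} • s = 0` for every `s ∈ Sel_(2^M)(E/ℚ)`, every `M` — SHARP;
* `two_pow_M0_smul_eq_zero_of_mem_sha_rat_of_regularPairSupply` — hence `2^{M₀} · Ш(E/ℚ)[2^∞] = 0`.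

So on `Δ > 0` (U⁺_T's habitat, where every Kolyvagin prime of the `c₀`-kind loses the top bit) the ℚ-side sharp exponent (B2Q⁺) — and with
gk2-p3 g27's sign-free descent the item U⁺_T on the odd-twin cut — is reduced to EXACTLY `hPair`.  Proof = g22's, step for step (adapted from
`…RTSharpExponentRat`), with the replacements above; the Kolyvagin-prime bookkeeping (`λ`, good reduction, residue degree `2`, the involution on
`E[2^M] ⊆ E[2^{M+1}]`) is re-derived from the Zhang clauses.

References: [Kolyvagin1989Izv] Thm. B₂, §3; [McCallumLMS1991] §3 Cor. 3.2, §4 Prop. 4.4, Lemma 4.6, §5 Lemma 5.3; [GrossLMS1991] §3 (3.1)–(3.3),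
Props. 5.4, 6.2, 8.2, §10; [MilneADT2006] I Thm. 4.10, Cor. 3.4, Rem. 3.7; [SerreGaloisCohomology1997] I §2.4.
-/

set_option autoImplicit false
-- the Theorems namespace of this sub repeats the summit name by design (D-0017 nested layout)
set_option linter.dupNamespace false

noncomputable section

open scoped Classical
open scoped AddSubgroup

namespace Summit.BirchSwinnertonDyer.BirchSwinnertonDyer.Theorems.GenusExact.PlusDescent

open WeierstrassCurve NumberField IsDedekindDomain Field Rat.HeightOneSpectrum Literature.NumberTheory.EllipticCurves
  Literature.NumberTheory.GaloisRepresentations Literature.NumberTheory.EllipticCurves.ModularForms AddSubgroup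
  Literature.NumberTheory.EllipticCurves.RingClassField
open Summit.BirchSwinnertonDyer.BirchSwinnertonDyer.Theses.GenusKolyvaginAtTwo (KolyvaginRelationAtTwo)
open Summit.BirchSwinnertonDyer.Rank1Residual
open Summit.BirchSwinnertonDyer.BirchSwinnertonDyer.Theorems.GenusExact
open Summit.BirchSwinnertonDyer.BirchSwinnertonDyer.Theorems.GenusExact.VisiblePairAtTwo
  (liesOver_of_natCast_mem natCast_mem_primesEquiv_symm natCast_prime_mem_iff_eq hasGoodReductionAt_of_hasGoodReductionAtPrime
    not_mem_range intCast_notMem_of_not_dvd)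
open Summit.BirchSwinnertonDyer.BirchSwinnertonDyer.Theorems.OffBigImageOddLocalAtTwo

/-- An involution of `E[n]` is an involution of `E[d]` for `d ∣ n` (`E[d] ⊆ E[n]` inside `E(ℚ̄)`). [folklore] -/
theorem smul_smul_eq_self_of_dvd (W : WeierstrassCurve ℚ) {d n : ℤ} (hdn : d ∣ n) {h : absoluteGaloisGroup ℚ}
    (hsq : ∀ X : geomTorsion W n, h • h • X = X) (P : geomTorsion W d) : h • h • P = P := by
  have hP : (P : geomPoints W) ∈ geomTorsion W n := geomTorsion_le_of_dvd W hdn P.2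
  have h1 := congrArg Subtype.val (hsq ⟨P, hP⟩)
  simp only [Literature.NumberTheory.EllipticCurves.AddSubgroup.torsionBy.coe_smul] at h1
  apply Subtype.ext
  simp only [Literature.NumberTheory.EllipticCurves.AddSubgroup.torsionBy.coe_smul]
  exact h1

/-- A moved point of `E[((2 : ℕ) : ℤ)]` is a moved point of `E[(2 : ℤ)]` (the two spellings of the level). [folklore] -/
theorem exists_smul_ne_two_of_natCast (W : WeierstrassCurve ℚ) {h : absoluteGaloisGroup ℚ}
    (hu : ∃ u : geomTorsion W ((2 : ℕ) : ℤ), h • u ≠ u) : ∃ u : geomTorsion W (2 : ℤ), h • u ≠ u := by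
  obtain ⟨u, hu⟩ := hu
  have hmem : (u : geomPoints W) ∈ geomTorsion W (2 : ℤ) := by
    rw [mem_geomTorsion_iff]
    have h2 := (mem_geomTorsion_iff W _ (u : geomPoints W)).mp u.2
    exact_mod_cast h2
  refine ⟨⟨u, hmem⟩, fun heq ↦ hu ?_⟩
  have h1 := congrArg Subtype.val heq
  simp only [Literature.NumberTheory.EllipticCurves.AddSubgroup.torsionBy.coe_smul] at h1
  apply Subtype.ext
  simp only [Literature.NumberTheory.EllipticCurves.AddSubgroup.torsionBy.coe_smul]
  exact h1

/-- **(B2Q±) Kolyvagin's Theorem B₂ at `l = 2` over `ℚ`, SHARP, for EITHER SIGN of `Δ(E)`, modulo the regular signed pair-Čebotarev supply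
`hPair`: `2^{M₀} • s = 0` for every `s ∈ Sel_(2^M)(E/ℚ)`, every `M`** (modulo Q2; `w(E) = +1`).  See the module docstring.  On `Δ < 0` this is
g22's `two_pow_smul_selmer_rat_eq_zero_onHabitat` (there `hPair` holds with `h = c₀`); on `Δ > 0` it is (B2Q⁺) reduced to `hPair`.
(Proof adapted from `…RTSharpExponentRat.two_pow_smul_selmer_rat_eq_zero_onHabitat`, gk2-p4 g22.)
[cite: Kolyvagin1989Izv, Thm. B₂, §3] [cite: McCallumLMS1991, §3 Cor. 3.2, §4 Prop. 4.4, §5 Lemma 5.3] [cite: GrossLMS1991, §10, Props. 5.4, 6.2, 8.2] -/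
theorem two_pow_smul_selmer_rat_eq_zero_of_regularPairSupply (hQ2 : KolyvaginRelationAtTwo)
    (W : WeierstrassCurve ℚ) [W.IsElliptic] [W.IsGloballyMinimal] [NeZero (W.conductorNorm ℤ)] (hcm : ¬ W.HasCM)
    (hT : Odd W.tamagawaProduct) (v : HeightOneSpectrum (𝓞 ℚ)) (h2v : ((2 : ℕ) : 𝓞 ℚ) ∉ v.asIdeal)
    (hNv : ((W.conductorNorm ℤ : ℕ) : 𝓞 ℚ) ∈ v.asIdeal) (hmult : W.HasMultiplicativeReductionAt v)
    (K : Type) [Field K] [NumberField K] (hIQ : IsImaginaryQuadratic K) (hodd : Odd (NumberField.discr K))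
    (h3 : NumberField.discr K ≠ -3) (hHe : SatisfiesHeegnerHypothesis (W.conductorNorm ℤ) K)
    (hsq1 : ¬ IsSquare ((NumberField.discr K : ℚ) * -|W.Δ|)) (hsq2 : ¬ IsSquare ((NumberField.discr K : ℚ) * (-(2 * |W.Δ|))))
    (hρ : ∀ n : ℕ, 0 < n → W.HasSurjectiveModNGaloisRep ((2 : ℤ) ^ n))
    (Dt : ModularParametrizationData W (W.conductorNorm ℤ)) (β : ℤ) (ι : K →+* ℂ) (d₁ : KolyvaginHeegnerData Dt β ι 1) (M₀ : ℕ)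
    (hndiv : ¬ ∃ Q : (W.baseChange (ringClassField K ι 1)).toAffine.Point, ((2 ^ (M₀ + 1) : ℕ) : ℤ) • Q = d₁.derivedPoint)
    (hw1 : W.rootNumber = 1)
    (hPair : ∀ (n : ℕ) (c : K ≃ₐ[ℚ] K), c ≠ 1 →
      ∀ (x y : galH1Torsion (W.baseChange K) ((2 ^ (n + 1) : ℕ) : ℤ)) (ex ey : ℕ), 1 ≤ ex → 1 ≤ ey →
      addOrderOf x = 2 ^ ex → addOrderOf y = 2 ^ ey →
      ∀ (sx sy : ℤ), (sx = 1 ∨ sx = -1) → (sy = 1 ∨ sy = -1) →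
      conjAct W c ((2 ^ (n + 1) : ℕ) : ℤ) x = sx • x → conjAct W c ((2 ^ (n + 1) : ℕ) : ℤ) y = sy • y →
      (∀ a b : ℤ, (∀ ρ ∈ torsionFixing (W.baseChange K) ((2 ^ (n + 1) : ℕ) : ℤ),
          h1Eval (W.baseChange K) ((2 ^ (n + 1) : ℕ) : ℤ) (a • x + b • y) ρ = 0) → a • x + b • y = 0) →
      ∃ ℓ : ℕ, Zhang2014.IsKolyvaginPrime (W.conductorNorm ℤ) W K 2 ℓ ∧ n + 1 ≤ Zhang2014.kolyvaginIndex W 2 ℓ ∧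
        (∃ (v : HeightOneSpectrum (𝓞 ℚ)) (𝔓 : Ideal (absIntegers (𝓞 ℚ) ℚ)) (h c₀ : absoluteGaloisGroup ℚ),
          (ℓ : 𝓞 ℚ) ∈ v.asIdeal ∧ 𝔓 ∈ v.primesAbove ∧ IsArithFrobAt (𝓞 ℚ) h 𝔓 ∧ IsComplexConjugation (Rat.castHom ℝ) c₀ ∧
          (∀ X : geomTorsion W ((2 ^ (n + 1) : ℕ) : ℤ), h • h • X = X) ∧
          (∃ u : geomTorsion W ((2 : ℕ) : ℤ), h • u ≠ u) ∧
          ∀ (e : K →ₐ[ℚ] AlgebraicClosure ℚ) (z : K), h • e z = c₀ • e z) ∧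
        ∀ w : HeightOneSpectrum (𝓞 K), (ℓ : 𝓞 K) ∈ w.asIdeal →
          (∀ j : ℕ, ((2 ^ j : ℕ) : ℤ) • x ∈ (W.baseChange K).torsionLocalKer (w.adicCompletion K) ((2 ^ (n + 1) : ℕ) : ℤ) ↔ ex ≤ j) ∧
          (∀ j : ℕ, ((2 ^ j : ℕ) : ℤ) • y ∈ (W.baseChange K).torsionLocalKer (w.adicCompletion K) ((2 ^ (n + 1) : ℕ) : ℤ) ↔ ey ≤ j))
    (M : ℕ) (s₀ : galH1Torsion W ((2 ^ M : ℕ) : ℤ)) (hs₀ : s₀ ∈ selmerGroup W ((2 ^ M : ℕ) : ℤ)) :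
    ((2 ^ M₀ : ℕ) : ℤ) • s₀ = 0 := by
  haveI : Fact (Nat.Prime 2) := ⟨Nat.prime_two⟩
  haveI : ∀ j : ℕ, NumberField (ringClassField K ι j) := JET.numberField_ringClassField K hIQ ι
  haveI hell : (W.baseChange K).IsElliptic := inferInstanceAs ((W.map (algebraMap ℚ K)).IsElliptic)
  -- ### the trivial range `M ≤ M₀`
  by_cases hMM₀ : M ≤ M₀
  · obtain ⟨e, he⟩ := Nat.exists_eq_add_of_le hMM₀
    have h0 : ((2 ^ M : ℕ) : ℤ) • s₀ = 0 := zsmul_discreteH1_torsion _ s₀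
    have hpow : ((2 ^ M₀ : ℕ) : ℤ) = ((2 ^ e : ℕ) : ℤ) * ((2 ^ M : ℕ) : ℤ) := by
      rw [he, pow_add]; push_cast; ring
    rw [hpow, mul_smul, h0, zsmul_zero]
  have hM₀M : M₀ + 1 ≤ M := by omega
  have hM : 1 ≤ M := le_trans (Nat.le_add_left 1 M₀) hM₀M
  have hM' : 1 ≤ M + 1 := by omega
  -- ### numerics and currencies
  have hsurN : ∀ m : ℕ, W.HasSurjectiveModNGaloisRep ((2 ^ m : ℕ) : ℤ) :=
    MinimalTwinBSDTwo.forall_hasSurjectiveModNGaloisRep_two_pow_of_pos W hρ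
  have hρN : ∀ m : ℕ, W.HasSurjectiveModNGaloisRep (2 ^ m : ℕ) := fun m ↦ by exact_mod_cast hsurN m
  have hsurj1 : W.HasSurjectiveModNGaloisRep ((2 : ℤ) ^ 1) := hρ 1 one_pos
  have hs2 : W.HasSurjectiveModNGaloisRep 2 := by simpa using hsurj1
  have h2 : Module.finrank ℚ K = 2 := hIQ.1
  have hN : (W.conductorNorm ℤ) ≠ 0 := NeZero.ne _
  have hD4 : NumberField.discr K ≠ -4 := fun h ↦ by
    rw [h] at hodd; exact (Int.not_even_iff_odd.mpr hodd) ⟨-2, by norm_num⟩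
  have hD : NumberField.discr K < -4 := X11b.KolyvaginAssembly.discr_lt_neg_four hIQ ⟨h3, hD4⟩
  -- the complex conjugation `τ = σ_θ`, `θ² = d_K`
  obtain ⟨θ, hθ, hd⟩ := Literature.NumberTheory.QuadraticFields.Quadratic.exists_not_mem_range_sq_eq_discr (K := K) h2
  set τ : K ≃ₐ[ℚ] K := sigmaQ K h2 hθ hd with hτdef
  have hτ : τ ≠ 1 := sigmaQ_ne_one K h2 hθ hd
  -- ### no `2`-power torsion in `E(K)`
  have htorsK : ∀ (m : ℕ) (P : (W.baseChange K).toAffine.Point), ((2 ^ m : ℕ) : ℤ) • P = 0 → P = 0 := fun m P hP ↦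
    EigenClassesFinite.forall_zsmul_two_pow_baseChange_eq_zero_of_hasSurjectiveModNGaloisRep_two W K h2 hs2 m P
      (by exact_mod_cast hP)
  -- ### (NPh) at levels `M` and `M + 1` from the multiplicative prime
  have hNPh : ∀ (L : ℕ), 1 ≤ L → ∀ z : galH1Torsion (W.baseChange K) ((2 ^ L : ℕ) : ℤ),
      (∀ ρ' ∈ torsionFixing (W.baseChange K) ((2 ^ L : ℕ) : ℤ), h1Eval (W.baseChange K) ((2 ^ L : ℕ) : ℤ) z ρ' = 0) →
      (∀ w : HeightOneSpectrum (𝓞 K), z ∈ selmerLocalKer (W.baseChange K) (w.adicCompletion K) ((2 ^ L : ℕ) : ℤ)) → z = 0 :=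
    fun L hL z hz hzS ↦ NonPhantomPow.nonPhantomAtTwo_of_hasMultiplicativeReductionAt (W := W) (K := K) hT hρ hIQ hodd hsq1 hsq2 hN hHe
      h2v hNv hmult L hL z hz (fun w _ ↦ hzS w)
  -- ### the Selmer class over `K`: `s = res s₀`, `τ`-invariant, same order `2^a`
  set s := resTorsion W K ((2 ^ M : ℕ) : ℤ) s₀ with hsdef
  have hsSel : s ∈ selmerGroup (W.baseChange K) ((2 ^ M : ℕ) : ℤ) := resTorsion_mem_selmerGroup W K ((2 ^ M : ℕ) : ℤ) hs₀
  have hinjres : Function.Injective (resTorsion W K ((2 ^ M : ℕ) : ℤ)) :=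
    EigenClassesFinite.resTorsion_injective_of_noTorsion W K h2 hθ hd ((2 ^ M : ℕ) : ℤ) (htorsK M)
  have hτs : conjAct W τ ((2 ^ M : ℕ) : ℤ) s = s :=
    (EigenClassesFinite.mem_range_resTorsion_iff_conjAct_eq W K h2 hθ hd ((2 ^ M : ℕ) : ℤ) (htorsK M) s).mp ⟨s₀, rfl⟩
  obtain ⟨a, haM, ha⟩ := exists_addOrderOf_galH1Torsion_eq_two_pow W K M s
  by_cases ha0 : a = 0
  · -- `s = 0`, hence `s₀ = 0`
    have hs0 : s = 0 := AddMonoid.addOrderOf_eq_one_iff.mp (by rw [ha, ha0, pow_zero])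
    have : s₀ = 0 := hinjres (by rw [← hsdef, hs0, map_zero])
    rw [this, zsmul_zero]
  have ha1 : 1 ≤ a := Nat.one_le_iff_ne_zero.mpr ha0
  -- ### the Heegner class `y = c_M(1) = δ Ph`, order `2^κ`, `κ ≥ M − M₀`, sign `−1`
  have hdiv : ∀ P : geomPoints (W.baseChange K), ∃ Q : geomPoints (W.baseChange K), ((2 ^ M : ℕ) : ℤ) • Q = P :=
    (W.baseChange K).zsmul_geomPoints_surjective_of_charZero (by positivity)
  set δ := kummerMapTorsion (W.baseChange K) ((2 ^ M : ℕ) : ℤ) hdiv with hδ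
  have hker : δ.ker = (zsmulAddGroupHom (α := (W.baseChange K).toAffine.Point) ((2 ^ M : ℕ) : ℤ)).range := kummerMapTorsion_ker (W.baseChange K) ((2 ^ M : ℕ) : ℤ) hdiv
  obtain ⟨Ph, hPh, hPhmap⟩ := AdditiveKoly.exists_isHeegnerPoint_map_eq_derivedPoint_one (W := W) (K := K) (Dt := Dt) (β := β)
    (ι := ι) hIQ hHe d₁
  set y := d₁.kolyvaginClass Nat.prime_two M with hydef
  have hc1 : y = δ Ph := VisiblePairAtTwo.kolyvaginClass_one_two_eq_kummerMapTorsion W K hIQ hodd hHe hsurj1 M d₁ Ph hPhmap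
  have hP₀ : ∀ Q : (W.baseChange K).toAffine.Point, ((2 ^ (M₀ + 1) : ℕ) : ℤ) • Q ≠ Ph :=
    forall_two_pow_smul_ne_bottom_of_not_dvd_derivedPoint d₁ Ph hPhmap le_rfl hndiv
  obtain ⟨κ, hκM, hκ⟩ := exists_addOrderOf_galH1Torsion_eq_two_pow W K M y
  have hκge : M - M₀ ≤ κ := by
    by_contra hlt'
    have h0 : ((2 ^ κ : ℕ) : ℤ) • y = 0 := (two_pow_zsmul_eq_zero_iff_of_addOrderOf W K hκ κ).mpr le_rfl
    have hmem : ((2 ^ κ : ℕ) : ℤ) • Ph ∈ δ.ker := by rw [AddMonoidHom.mem_ker, map_zsmul, ← hc1, h0]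
    rw [hker] at hmem
    obtain ⟨R, hR⟩ := hmem
    have hPhR : Ph = ((2 ^ (M - κ) : ℕ) : ℤ) • R := eq_two_pow_zsmul_of_two_pow_zsmul_eq (htorsK 1 · <| by simpa using ·) hκM hR
    refine hP₀ (((2 ^ (M - κ - (M₀ + 1)) : ℕ) : ℤ) • R) ?_
    rw [hPhR, smul_smul]
    congr 1
    push_cast
    rw [← pow_add]
    congr 1
    omega
  have hκ1 : 1 ≤ κ := by omega
  have h1K : ∀ q ∈ (1 : ℕ).primeFactors, Zhang2014.IsKolyvaginPrime (W.conductorNorm ℤ) W K 2 q ∧ M ≤ Zhang2014.kolyvaginIndex W 2 q := by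
    simp
  obtain ⟨-, hτy⟩ := KolyvaginClassSign.sign_conjAct_kolyvaginClass_two hIQ h3 hD4 hodd hHe hsurj1 τ hτ Dt β ι squarefree_one hM h1K d₁
  rw [Nat.primeFactors_one, Finset.card_empty, pow_zero, mul_one, hw1] at hτy
  -- ### ONE LEVEL UP: `ι_* s`, `ι_* y` at level `2^(M+1)`
  have hdvd : ((2 ^ M : ℕ) : ℤ) ∣ ((2 ^ (M + 1) : ℕ) : ℤ) := KolyvaginPairDataTwo.two_pow_dvd_two_pow_succ M
  set ιM := torsionH1OfDvd (W.baseChange K) hdvd with hιM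
  have hιinj : Function.Injective ιM := KolyvaginPairDataTwo.torsionH1OfDvd_succ_injective W M hIQ hs2
  have hsSel' : ιM s ∈ selmerGroup (W.baseChange K) ((2 ^ (M + 1) : ℕ) : ℤ) := torsionH1OfDvd_mem_selmerGroup (W.baseChange K) hdvd hsSel
  have hySel : y ∈ selmerGroup (W.baseChange K) ((2 ^ M : ℕ) : ℤ) := by
    rw [hc1]; exact WeierstrassCurve.kummerMapTorsion_mem_selmerGroup (W.baseChange K) _ hdiv Ph
  have hySel' : ιM y ∈ selmerGroup (W.baseChange K) ((2 ^ (M + 1) : ℕ) : ℤ) := torsionH1OfDvd_mem_selmerGroup (W.baseChange K) hdvd hySel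
  have hords' : addOrderOf (ιM s) = 2 ^ a := by rw [addOrderOf_injective ιM hιinj, ha]
  have hordy' : addOrderOf (ιM y) = 2 ^ κ := by rw [addOrderOf_injective ιM hιinj, hκ]
  have hτs' : conjAct W τ ((2 ^ (M + 1) : ℕ) : ℤ) (ιM s) = (1 : ℤ) • ιM s := by
    rw [one_zsmul, hιM, conjAct_torsionH1OfDvd W τ hdvd s, hτs]
  have hτy' : conjAct W τ ((2 ^ (M + 1) : ℕ) : ℤ) (ιM y) = (-1 : ℤ) • ιM y := by
    rw [hιM, conjAct_torsionH1OfDvd W τ hdvd y, hτy, map_zsmul]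
  -- separation for the pair from (NPh_{M+1}): both classes are Selmer
  have hres : ∀ a' b' : ℤ, (∀ ρ' ∈ torsionFixing (W.baseChange K) ((2 ^ (M + 1) : ℕ) : ℤ), h1Eval (W.baseChange K) ((2 ^ (M + 1) : ℕ) : ℤ) (a' • ιM s + b' • ιM y) ρ' = 0) →
      a' • ιM s + b' • ιM y = 0 := by
    intro a' b' hab
    have hmem : a' • ιM s + b' • ιM y ∈ selmerGroup (W.baseChange K) ((2 ^ (M + 1) : ℕ) : ℤ) :=
      add_mem (AddSubgroup.zsmul_mem _ hsSel' a') (AddSubgroup.zsmul_mem _ hySel' b')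
    exact hNPh (M + 1) hM' _ hab (fun w ↦ (((W.baseChange K).mem_selmerGroup_iff _ _).mp hmem).1 w)
  -- ### the REGULAR Kolyvagin prime from the displayed supply `hPair` (level `2^(M+1)`, signs `(+1, −1)`)
  obtain ⟨ℓ, hkolZ, hidx', hfrob, hloc'⟩ := hPair M τ hτ (ιM s) (ιM y) a κ ha1 hκ1 hords' hordy' 1 (-1) (Or.inl rfl)
    (Or.inr rfl) hτs' hτy' hres
  obtain ⟨hℓp, hℓN, hℓdK, hℓ2, hℓprime, hidxpos⟩ := hkolZ
  haveI : Fact ℓ.Prime := ⟨hℓp⟩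
  have hkolZ : Zhang2014.IsKolyvaginPrime (W.conductorNorm ℤ) W K 2 ℓ := ⟨hℓp, hℓN, hℓdK, hℓ2, hℓprime, hidxpos⟩
  obtain ⟨vP, 𝔓, hfr, c₀, hℓvP, h𝔓, hhfr, hc₀, hhsq, hhu, hhK⟩ := hfrob
  -- the place `λ = (ℓ)` of `K`
  set w : HeightOneSpectrum (𝓞 K) := ⟨Ideal.span {(ℓ : 𝓞 K)}, hℓprime, by
    rw [Ne, Ideal.span_singleton_eq_bot]; exact_mod_cast hℓp.ne_zero⟩ with hwdef
  have hwℓ : (ℓ : 𝓞 K) ∈ w.asIdeal := Ideal.mem_span_singleton_self _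
  -- the rational place `v_ℓ` and its local data
  set vℓ : HeightOneSpectrum (𝓞 ℚ) := primesEquiv.symm ⟨ℓ, hℓp⟩ with hvℓdef
  have hℓv : (ℓ : 𝓞 ℚ) ∈ vℓ.asIdeal := natCast_mem_primesEquiv_symm hℓp
  have hvPℓ : vP = vℓ := (natCast_prime_mem_iff_eq hℓp vP).mp hℓvP
  obtain ⟨h2vℓ, hqv⟩ := SelmerDescent.two_notMem_and_natCast_two_pow_notMem (rfl : 2 ^ M = 2 ^ M) hℓp hℓ2 hℓv
  have hdKv : ((NumberField.discr K : ℤ) : 𝓞 ℚ) ∉ vℓ.asIdeal := intCast_notMem_of_not_dvd hℓp hℓv hℓdK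
  haveI hLO : w.asIdeal.LiesOver vℓ.asIdeal := liesOver_of_natCast_mem hℓp hℓv hwℓ
  have hgood : W.HasGoodReductionAtPrime ℓ := hasGoodReductionAtPrime_of_not_dvd_conductorNorm W hℓN
  have hgoodv : W.HasGoodReductionAt vℓ := hasGoodReductionAt_of_hasGoodReductionAtPrime W hgood hℓv
  have hgoodK : (W.baseChange K).HasGoodReductionAt w := Engine.hasGoodReductionAt_baseChange_of_rat W hℓp hℓv hgoodv hwℓ
  have hf : w.asIdeal.inertiaDeg (𝓞 ℚ) = 2 :=
    Summit.BirchSwinnertonDyer.Rank1Residual.X11b.Three.Koly.Method2.LocalFrob.inertiaDeg_eq_two_of_isPrime_span K h2 hℓp hℓprime w hwℓ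
  -- the regular Frobenius datum in the three consumer shapes
  have hfrob' : ∃ (v' : HeightOneSpectrum (𝓞 ℚ)) (𝔓' : Ideal (absIntegers (𝓞 ℚ) ℚ)) (h' : absoluteGaloisGroup ℚ),
      (ℓ : 𝓞 ℚ) ∈ v'.asIdeal ∧ 𝔓' ∈ v'.primesAbove ∧ IsArithFrobAt (𝓞 ℚ) h' 𝔓' ∧
      (∀ P : geomTorsion W ((2 ^ (M + 1) : ℕ) : ℤ), h' • P = hfr • P) ∧
      ∀ (e : K →ₐ[ℚ] AlgebraicClosure ℚ) (z : K), h' • e z = c₀ • e z :=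
    ⟨vP, 𝔓, hfr, hℓvP, h𝔓, hhfr, fun _ ↦ rfl, hhK⟩
  have h𝔓ℓ : 𝔓 ∈ vℓ.primesAbove := hvPℓ ▸ h𝔓
  have hreg2 : ∃ (𝔓' : Ideal (absIntegers (𝓞 ℚ) ℚ)) (h' : absoluteGaloisGroup ℚ), 𝔓' ∈ vℓ.primesAbove ∧
      IsArithFrobAt (𝓞 ℚ) h' 𝔓' ∧ (∀ P : geomTorsion W ((2 : ℕ) : ℤ), h' • h' • P = P) ∧
      ∃ u : geomTorsion W ((2 : ℕ) : ℤ), h' • u ≠ u :=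
    ⟨𝔓, hfr, h𝔓ℓ, hhfr, smul_smul_eq_self_of_dvd W (by exact_mod_cast dvd_pow_self 2 (Nat.succ_ne_zero M)) hhsq, hhu⟩
  have hregM : ∃ (𝔓' : Ideal (absIntegers (𝓞 ℚ) ℚ)) (h' : absoluteGaloisGroup ℚ), 𝔓' ∈ vℓ.primesAbove ∧
      IsArithFrobAt (𝓞 ℚ) h' 𝔓' ∧ (∀ X : geomTorsion W ((2 ^ M : ℕ) : ℤ), h' • h' • X = X) ∧
      ∃ u : geomTorsion W 2, h' • u ≠ u :=
    ⟨𝔓, hfr, h𝔓ℓ, hhfr, smul_smul_eq_self_of_dvd W hdvd hhsq, exists_smul_ne_two_of_natCast W hhu⟩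
  -- ### full local orders at `λ`, transferred back to level `2^M` (`Γ_{K_λ}` fixes `E[2^(M+1)]`)
  obtain ⟨hαs', hαy'⟩ := hloc' w hwℓ
  have hmw : ((((2 ^ (M + 1) : ℕ) : ℕ) : ℤ) : 𝓞 K) ∉ w.asIdeal := fun hm ↦ by
    apply not_natCast_mem_of_prime_ne hℓp Nat.prime_two hℓ2 w hwℓ
    rw [Int.cast_natCast, Nat.cast_pow] at hm
    exact w.isPrime.mem_of_pow_mem _ hm
  haveI : NeZero (2 ^ (M + 1)) := ⟨pow_ne_zero _ two_ne_zero⟩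
  have htriv : ∀ (g : absoluteGaloisGroup (w.adicCompletion K)) (Q : geomTorsion (W.baseChange K) ((2 ^ (M + 1) : ℕ) : ℤ)),
      resGal (K := K) (w.adicCompletion K) g • Q = Q := fun g Q ↦
    Engine.absGaloisRestrict_smul_geomTorsion_eq_regular W hIQ hc₀ hhsq hℓp hℓprime hfrob' hwℓ hgoodK hmw g Q
  have htrans : ∀ x : galH1Torsion (W.baseChange K) ((2 ^ M : ℕ) : ℤ), x ∈ (W.baseChange K).torsionLocalKer (w.adicCompletion K) ((2 ^ M : ℕ) : ℤ) ↔
      ιM x ∈ (W.baseChange K).torsionLocalKer (w.adicCompletion K) ((2 ^ (M + 1) : ℕ) : ℤ) := fun x ↦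
    mem_torsionLocalKer_iff_torsionH1OfDvd_mem (W.baseChange K) (w.adicCompletion K) (pow_dvd_pow 2 (Nat.le_succ M))
      (pow_ne_zero _ two_ne_zero) (pow_ne_zero _ two_ne_zero) htriv x
  have hαs : ∀ j : ℕ, ((2 ^ j : ℕ) : ℤ) • s ∈ (W.baseChange K).torsionLocalKer (w.adicCompletion K) ((2 ^ M : ℕ) : ℤ) ↔ a ≤ j := fun j ↦ by
    rw [htrans, map_zsmul]; exact hαs' j
  have hαy : ∀ j : ℕ, ((2 ^ j : ℕ) : ℤ) • y ∈ (W.baseChange K).torsionLocalKer (w.adicCompletion K) ((2 ^ M : ℕ) : ℤ) ↔ κ ≤ j := fun j ↦ by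
    rw [htrans, map_zsmul]; exact hαy' j
  -- ### the datum at conductor `ℓ` compatible with `d₁`, its class `x = c_M(ℓ)` (sign `+1`) and Q2 at `λ`
  obtain ⟨dℓ, hdℓ⟩ := JET.exists_compatible_data_of_grossCM
    (phi_heegnerPointOfConductor_mem_range_map_ringClassField_holds (W.conductorNorm ℤ) W K) hIQ hD hHe 2 Dt β ι
    squarefree_one (by simp) d₁
  have hℓ1 : ℓ ∉ (1 : ℕ).primeFactors := by simp
  obtain ⟨hσ', hS', hS'', hemb'⟩ := hdℓ ℓ hkolZ hℓ1
  set d' := dℓ ℓ hkolZ hℓ1 with hd'_def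
  set x := d'.kolyvaginClass Nat.prime_two M with hx_def
  have hc' : Squarefree (1 * ℓ) := by rw [one_mul]; exact hℓp.squarefree
  have hℓn : ¬ ℓ ∣ 1 := fun h ↦ hℓp.one_lt.ne' (Nat.dvd_one.mp h)
  have hkM : ∀ q ∈ (1 * ℓ).primeFactors, Zhang2014.IsKolyvaginPrime (W.conductorNorm ℤ) W K 2 q ∧ M ≤ Zhang2014.kolyvaginIndex W 2 q := by
    intro q hq
    rw [one_mul, hℓp.primeFactors, Finset.mem_singleton] at hq
    subst hq
    exact ⟨hkolZ, le_trans (Nat.le_succ M) hidx'⟩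
  have hkM1 : ∀ q ∈ (1 * ℓ).primeFactors, Zhang2014.IsKolyvaginPrime (W.conductorNorm ℤ) W K 2 q ∧
      M + 1 ≤ Zhang2014.kolyvaginIndex W 2 q := by
    intro q hq
    rw [one_mul, hℓp.primeFactors, Finset.mem_singleton] at hq
    subst hq
    exact ⟨hkolZ, hidx'⟩
  have hcard : (1 * ℓ).primeFactors.card = 1 := by rw [one_mul, hℓp.primeFactors, Finset.card_singleton]
  -- signs: `c_M(ℓ)`, `c_{M+1}(ℓ)` are `τ`-invariant (`−w·(−1) = +1`)
  obtain ⟨-, hx⟩ := KolyvaginClassSign.sign_conjAct_kolyvaginClass_two hIQ h3 hD4 hodd hHe hsurj1 τ hτ Dt β ι hc' hM hkM d'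
  obtain ⟨-, hx1⟩ := KolyvaginClassSign.sign_conjAct_kolyvaginClass_two hIQ h3 hD4 hodd hHe hsurj1 τ hτ Dt β ι hc' hM' hkM1 d'
  rw [hcard, pow_one, hw1] at hx hx1
  norm_num at hx hx1
  -- Q2 at the own prime: Selmer threshold of `x` at `λ` = zero threshold `κ` of `y`
  have hQ := hQ2 W hcm K hIQ h3 hD4 hHe hρN Dt β ι M hM 1 ℓ hc' hℓp hℓn hkM d₁ d' hσ' hS' hS'' hemb' w hwℓ
  have hβ : ∀ j : ℕ, ((2 ^ j : ℕ) : ℤ) • x ∈ selmerLocalKer (W.baseChange K) (w.adicCompletion K) ((2 ^ M : ℕ) : ℤ) ↔ κ ≤ j :=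
    fun j ↦ (hQ j).1.trans (((hQ j).2).trans (hαy j))
  -- ### the ℚ-descent `u` of `x` (TQ-DEEP, margin one): Selmer at every finite `v' ≠ v_ℓ` and — by ARCH-M1 — at `∞`
  obtain ⟨u, hu, -⟩ := EigenClassesFinite.existsUnique_resTorsion_eq_of_conjAct_eq W K h2 hθ hd ((2 ^ M : ℕ) : ℤ) (htorsK M) hx
  have hufin : ∀ v' : HeightOneSpectrum (𝓞 ℚ), v' ≠ vℓ → u ∈ selmerLocalKer W (v'.adicCompletion ℚ) ((2 ^ M : ℕ) : ℤ) := by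
    intro v' hv'
    have hv'' : ∀ w' : HeightOneSpectrum (𝓞 K), w'.asIdeal.LiesOver v'.asIdeal → ((1 * ℓ : ℕ) : 𝓞 K) ∉ w'.asIdeal := by
      intro w' hw' hmem
      rw [one_mul] at hmem
      have hvmem : (ℓ : 𝓞 ℚ) ∈ v'.asIdeal := by
        have h : algebraMap (𝓞 ℚ) (𝓞 K) (ℓ : 𝓞 ℚ) ∈ w'.asIdeal := by rwa [map_natCast]
        rw [← Ideal.mem_comap, ← Ideal.under_def, ← Ideal.LiesOver.over (P := w'.asIdeal) (p := v'.asIdeal)] at h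
        exact h
      exact hv' ((natCast_prime_mem_iff_eq hℓp v').mp hvmem)
    obtain ⟨u', hu', hsel⟩ := SelmerDescent.exists_descent_kolyvaginClass_two_mem_selmerLocalKer_of_margin W hsurN hT K hIQ h2 hθ hd h3
      hD4 hHe Dt β ι M hc' hkM1 d' (htorsK (M + 1)) hx1 hx v' hv''
    have huu : u' = u := hinjres (hu'.trans hu.symm)
    rw [← huu]
    exact hsel
  have huinf : ∀ w' : InfinitePlace ℚ, u ∈ selmerLocalKer W w'.Completion ((2 ^ M : ℕ) : ℤ) := fun w' ↦
    SelmerDescent.mem_selmerLocalKer_infinitePlace_of_resTorsion_eq_kolyvaginClass_two_of_margin W hsurN K hIQ h2 hθ hd h3 hD4 hHe Dt β ι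
      M hc' hkM1 d' (htorsK (M + 1)) hx1 hu w'
  -- the Selmer threshold of `u` at `v_ℓ` is `κ`: `2^(κ−1) • u` is NOT Selmer there
  have hudv : ((2 : ℤ) ^ (κ - 1)) • u ∉ selmerLocalKer W (vℓ.adicCompletion ℚ) ((2 ^ M : ℕ) : ℤ) := by
    intro hmem
    have h' : ((2 : ℤ) ^ (κ - 1)) • resTorsion W K ((2 ^ M : ℕ) : ℤ) u ∈ selmerLocalKer (W.baseChange K) (w.adicCompletion K) ((2 ^ M : ℕ) : ℤ) :=
      (SelmerDescent.zsmul_mem_selmerLocalKer_iff_resTorsion W h2 (not_mem_range hθ) hd ((2 ^ M : ℕ) : ℤ) vℓ w hgoodv hqv h2vℓ hdKv u _).mp hmem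
    rw [hu] at h'
    have h'' : ((2 ^ (κ - 1) : ℕ) : ℤ) • x ∈ selmerLocalKer (W.baseChange K) (w.adicCompletion K) ((2 ^ M : ℕ) : ℤ) := by exact_mod_cast h'
    have := (hβ (κ - 1)).mp h''
    omega
  -- ### McCallum 5.3 + 2.2 over `ℚ_ℓ` AT A REGULAR PRIME (no lost bit): `2^(M − κ) • s₀` vanishes at `v_ℓ`
  have hdual := Engine.lemma_5_3_rat_two_regular W hM (q := 2 ^ M) rfl hℓ2 hℓv hgood hreg2 (le_trans (Nat.le_succ M) hidx') hs₀
    hufin huinf hudv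
  have hexp : M - 1 - (κ - 1) = M - κ := by omega
  rw [hexp] at hdual
  -- transfer to `K_λ` by the REGULAR dictionary
  have hdualK : ((2 : ℤ) ^ (M - κ)) • s ∈ (W.baseChange K).torsionLocalKer (w.adicCompletion K) ((2 ^ M : ℕ) : ℤ) := by
    have h := (Engine.zsmul_mem_torsionLocalKer_iff_resTorsion_of_notMem_regular W hM (q := 2 ^ M) rfl hℓp hℓ2 hℓv hgoodv h2
      (not_mem_range hθ) hd hdKv hregM w hf s₀ ((2 : ℤ) ^ (M - κ))).mp hdual
    exact h
  have hdualK' : ((2 ^ (M - κ) : ℕ) : ℤ) • s ∈ (W.baseChange K).torsionLocalKer (w.adicCompletion K) ((2 ^ M : ℕ) : ℤ) := by exact_mod_cast hdualK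
  -- ### conclusion: `a ≤ M − κ ≤ M₀`
  have haMκ : a ≤ M - κ := (hαs (M - κ)).mp hdualK'
  have haM₀ : a ≤ M₀ := by omega
  have hs0 : ((2 ^ M₀ : ℕ) : ℤ) • s = 0 := (two_pow_zsmul_eq_zero_iff_of_addOrderOf W K ha M₀).mpr haM₀
  apply hinjres
  rw [map_zsmul, map_zero, ← hsdef, hs0]

end Summit.BirchSwinnertonDyer.BirchSwinnertonDyer.Theorems.GenusExact.PlusDescent

end
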